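/-
Copyright (c) 2026 the pub-hodgecm-mathlib formalisation cell (harness21).  Prover seat hodgecm-mathlib-R90-C10-p08 (g0) (free S1 hand), HCML SLAB R90-TF,
section S6 «Ch. 14.1–14.5 stable trace formula» (base `R90-C14`), S6 WAVE 3 OPEN CARDS (R90-C14-plan (g0), R90 bus 2026-09-04T16:50:09Z), card W3-c.
2026-09-04.
-/
import Literature.NumberTheory.Automorphic.HyperspecialUnitarySatakeTransformAdicCompletion   -- ★ `unitaryHeckeEigencharacterAdic(_eq)`, `unramifiedLocalConjDatum_localConjUniformizer`; brings ★ `isHeckeTriple_unitaryInt_adicCompletion`, `finite_residueField_adicCompletion`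
import Literature.NumberTheory.Automorphic.HyperspecialUnitarySatakeIsomorphismAdicCompletion  -- ★ `exists_galAdicCompletionMap_ne` (`σ_w ≠ id` at an inert place)
import Literature.NumberTheory.Automorphic.UnitaryRankOneUnramifiedCharacters                  -- ★ `UnramifiedLocalConjDatum.exists_generator_three`, `heckeEigencharacter_apply_generator` (`ℋ(U(3), K₀) = ℂ[T₁]`, `λ_β(T₁) = z + z⁻¹`)
import HarnessLib

/-!
# R90 · S6 «Ch. 14.1–14.5 stable trace formula» — WAVE 3 card W3-c: the unramified HECKE EIGEN-POLYNOMIALS of `U(J₀,3)(E_w)` EXHAUST `ℂ[z + z⁻¹]`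
# (`Theorems/R90S6HeckeEigenpolyThreeExists.lean`: every `Q(z + z⁻¹)` is `z ↦ λ_{(z,1,1)}(φ)` for some `φ ∈ ℋ(U(J₀,3)(E_w), K₀)`)

Cell `hodgecm-mathlib`, crux H413 (`stmt-HodgeConjecture-24833`), route of record `HCCMUnconditional`; programme R90-TF, section S6 (base `R90-C14`),
seat R90-C10-p08 (g0) (free S1 hand, default take by name 21:28Z); S6 WAVE 3 OPEN CARDS (R90-C14-plan (g0), R90 bus 16:50:09Z), card W3-c of the
sheet `R90/R90-C14-plan/g0/S6_wave3cd_targets.v1.R90-C14-plan-g0.lean` 04e65d4ba36b0ae2 :21–:26 (signature token-identical, namespace segment `.Wave3`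
dropped; AUDIT S6#W3 c∕c′∕d∕d′ CLEAN 16:50:32Z).  Helper lane `--supports stmt-HodgeConjecture-24833 --as helper`; THEOREMS ONLY (no definition, no instance,
no notation, no named fact, no `sorry`); imports = ★ Literature Satake files + HarnessLib (no Lines import).

THE PRINT [Rogawski1990, §4.5 p. 50 (unramified `σ_w` ↔ `W`-class of unramified characters of `T`), p. 55 `f^∧(z) = Tr(i_G(χ_z) f)`];
[CartierCorvallis1979, §IV Thm. 4.1, Cor. 4.2] (`ℋ(G, K) ≅ ℂ[Λ]^W`; in relative rank one `ℂ[Λ⁻]^W = ℂ[X]`, `X = x^{ℓ_1} + x^{ℓ_{-1}}`).  For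
`U(J₀, 3)(E_w)` at an inert unramified `w` the spherical Hecke algebra is `ℂ[T₁]` with `𝒮_w(T₁) = x^{(1,0,-1)} + x^{(-1,0,1)}`
(★ `UnramifiedLocalConjDatum.exists_generator_three`), and `λ_β(T₁) = z(β) + z(β)⁻¹`, `z(β) = β₀ β₂⁻¹` (★ `heckeEigencharacter_apply_generator`); at
`β = (z, 1, 1)` this is `z + z⁻¹`, so `λ_{(z,1,1)}(Q(T₁)) = Q(z + z⁻¹)` for every polynomial `Q` — the eigen-polynomials of `ℋ(U(J₀,3)(E_w), K₀)` are ALL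
the symmetric Laurent polynomials `Q(z + z⁻¹)` (the density input of the (14.5.1) Hecke variation: ★ `langlandsDichotomy` ∕ ★ `tsum_eq_integral_of_dense`
are fed with the family `{z ↦ λ_{(z,1,1)}(φ)}_{φ}`, and W3-c says this family is all of `ℂ[z + z⁻¹]`).

* `unitaryHeckeEigencharacterAdic_three_aeval` — the computation `λ_{(z,1,1)}(Q(T₁)) = Q(z + z⁻¹)` for any generator `T₁` with
  `𝒮_w(T₁) = x^{(1,0,-1)} + x^{(-1,0,1)}` (the `N = 3` twin of R90-C14-p03's `unitaryHeckeEigencharacterAdic_two_aeval`; reusable by W3-c′);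
* `exists_generator_unitaryHeckeAlgebraAdic_three` — such a `T₁` exists at `w` and generates (the adic packaging of ★ `exists_generator_three`);
* **`exists_hecke_eigenpoly_three`** — W3-c.
HONEST LABEL: local spherical Hecke algebra bookkeeping; proves no printed global statement.  HC_CM is proved only modulo the 7 printed
citations (2 remaining named inputs: hLiu418 = stmt-HodgeConjecture-24832, h413 = stmt-HodgeConjecture-24833) until rung 0 closes; count-neutral helper.

## Tree search
★ `exists_generator_three`, `heckeEigencharacter_apply_generator`, `laurentEvalAt_single_line_add`, `unitaryHeckeEigencharacterAdic_apply`,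
`unitarySatakeTransformAdic_eq`, `unramifiedLocalConjDatum_localConjUniformizer`, `exists_galAdicCompletionMap_ne`, `isHeckeTriple_unitaryInt_adicCompletion`,
`finite_residueField_adicCompletion`; Mathlib `Polynomial.aeval_algHom_apply`, `Polynomial.coe_aeval_eq_eval`, `Fin.prod_univ_three`.  Dedup:
`rg "exists_hecke_eigenpoly_three|EigencharacterAdic_three_aeval|HeckeAlgebraAdic_three"` — only the sheet's `sorry` (R90/, not in tree).

## References
* [Rogawski1990] J. D. Rogawski, *Automorphic Representations of Unitary Groups in Three Variables*, Ann. of Math. Stud. 123 (1990), §4.5 p. 50, p. 55.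
* [CartierCorvallis1979] P. Cartier, *Representations of 𝔭-adic groups: a survey*, PSPM 33.1 (1979), §IV (4.2)–(4.4), Thm. 4.1, Cor. 4.2.
* [Minguez2011] A. Mínguez, *Unramified representations of unitary groups* (2011), §4.
* [Satake1963] I. Satake, *Theory of spherical functions on reductive algebraic groups over 𝔭-adic fields*, Publ. Math. IHÉS 18 (1963), §§6–7.
-/

set_option autoImplicit false
-- the mandated namespace repeats the single-problem summit's segment (`HodgeConjecture.HodgeConjecture`)
set_option linter.dupNamespace false

noncomputable section

open NumberField IsDedekindDomain Polynomial
open Literature.NumberTheory.Automorphic Literature.NumberTheory.Automorphic.HermitianLattice Literature.NumberTheory.Automorphic.UnitaryGroup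

namespace Summit.HodgeConjecture.HodgeConjecture.R90.S6

variable {F E : Type} [Field F] [NumberField F] [Field E] [NumberField E] [Algebra F E] [Algebra.IsQuadraticExtension F E]
  (c : E ≃ₐ[F] E) (hc1 : c ≠ 1) (v : HeightOneSpectrum (𝓞 F)) (w : PlacesOver E v) (hw : c • w.1 = w.1)
  (hv : Algebra.IsUnramifiedIn (𝓞 E) v.asIdeal)

/-- The exponent line of `U(3)`, `ℓ_m = (m, 0, -m)`, is additive. [folklore] -/
private theorem line_three_add (a b : ℤ) :
    (fun i : Fin 3 => (a + b) * (1 - (i : ℕ))) = (fun i : Fin 3 => a * (1 - (i : ℕ))) + fun i : Fin 3 => b * (1 - (i : ℕ)) := by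
  funext i; simp only [Pi.add_apply]; ring

/-- **`λ_{(z,1,1)}(Q(T₁)) = Q(z + z⁻¹)` on `ℋ(U(J₀,3)(E_w), K₀)`**: for any Hecke operator `T₁` with `𝒮_w(T₁) = x^{(1,0,-1)} + x^{(-1,0,1)}`,
any polynomial `Q` and any `z ∈ ℂˣ`, the unramified eigencharacter with torus parameter `(z, 1, 1)` takes the value `Q(z + z⁻¹)` at `Q(T₁)`
(`λ_β = ev_β ∘ 𝒮_w`, `ev_{(z,1,1)}(x^{(1,0,-1)} + x^{(-1,0,1)}) = z + z⁻¹`). [cite: CartierCorvallis1979, §IV (4.2)–(4.4)] [cite: Rogawski1990, §4.5 p. 50] -/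
theorem unitaryHeckeEigencharacterAdic_three_aeval
    {T₁ : heckeAlgebra ℂ ↥(unitaryGroupOfForm (galAdicCompletionMap (L := E) c hw) ((StdForm.antidiagonal 3).over (w.1.adicCompletion E)))
      (unitaryInt (galAdicCompletionMap (L := E) c hw) ((StdForm.antidiagonal 3).over (w.1.adicCompletion E)))}
    (hT₁ : unitarySatakeTransformAdic c hc1 v w hw hv T₁ =
      AddMonoidAlgebra.single (fun i : Fin 3 => (1 : ℤ) * (1 - (i : ℕ))) (1 : ℂ) +
        AddMonoidAlgebra.single (fun i : Fin 3 => (-1 : ℤ) * (1 - (i : ℕ))) 1)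
    (Q : ℂ[X]) (z : ℂˣ) :
    unitaryHeckeEigencharacterAdic c hc1 v w hw hv ![z, 1, 1] (aeval T₁ Q) = Q.eval ((z : ℂ) + (z : ℂ)⁻¹) := by
  rw [← aeval_algHom_apply, unitaryHeckeEigencharacterAdic_apply, hT₁,
    laurentEvalAt_single_line_add (ℓ := fun m (i : Fin 3) => m * (1 - (i : ℕ))) line_three_add, coe_aeval_eq_eval]
  congr 1
  have hz : (∏ i : Fin 3, (((![z, 1, 1] : Fin 3 → ℂˣ) i : ℂ) ^ ((1 : ℤ) * (1 - ((i : ℕ) : ℤ))))) = (z : ℂ) := by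
    rw [Fin.prod_univ_three]
    simp
  rw [hz]

/-- **`ℋ(U(J₀,3)(E_w), K₀) = ℂ[T₁]` at an inert unramified place**: there is a Hecke operator `T₁` with `𝒮_w(T₁) = x^{(1,0,-1)} + x^{(-1,0,1)}`
such that every element of the spherical Hecke algebra is a polynomial in `T₁` (the adic packaging of ★ `exists_generator_three`).
[cite: CartierCorvallis1979, §IV Thm. 4.1] [cite: Satake1963, §§6–7] [cite: Minguez2011, §4] -/
theorem exists_generator_unitaryHeckeAlgebraAdic_three :
    ∃ T₁ : heckeAlgebra ℂ ↥(unitaryGroupOfForm (galAdicCompletionMap (L := E) c hw) ((StdForm.antidiagonal 3).over (w.1.adicCompletion E)))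
        (unitaryInt (galAdicCompletionMap (L := E) c hw) ((StdForm.antidiagonal 3).over (w.1.adicCompletion E))),
      unitarySatakeTransformAdic c hc1 v w hw hv T₁ =
          AddMonoidAlgebra.single (fun i : Fin 3 => (1 : ℤ) * (1 - (i : ℕ))) (1 : ℂ) +
            AddMonoidAlgebra.single (fun i : Fin 3 => (-1 : ℤ) * (1 - (i : ℕ))) 1 ∧
      ∀ T, ∃ P : ℂ[X], aeval T₁ P = T := by
  haveI := finite_residueField_adicCompletion E w.1
  haveI := isHeckeTriple_unitaryInt_adicCompletion c v w hw ((StdForm.antidiagonal 3).over (w.1.adicCompletion E))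
  obtain ⟨T₁, hT₁, hgen⟩ := (unramifiedLocalConjDatum_localConjUniformizer c hc1 v w hw hv).exists_generator_three
    (exists_galAdicCompletionMap_ne c hc1 v w hw)
  refine ⟨T₁, ?_, hgen⟩
  rw [unitarySatakeTransformAdic_eq c hc1 v w hw hv (unramifiedLocalConjDatum_localConjUniformizer c hc1 v w hw hv)]
  exact hT₁

/-- **W3-c — every symmetric Laurent polynomial `Q(z + z⁻¹)` is a Hecke eigen-polynomial of `U(J₀,3)(E_w)`** [Rogawski1990, §4.5 p. 50, p. 55;
CartierCorvallis1979 §IV Thm. 4.1]: for every `Q ∈ ℂ[X]` there is `φ ∈ ℋ(U(J₀,3)(E_w), K₀)` with `λ_{(z,1,1)}(φ) = Q(z + z⁻¹)` for ALL `z ∈ ℂˣ` —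
namely `φ = Q(T₁)`.  (Sheet `S6_wave3cd_targets.v1` :21–:26 token-for-token; supply lemma for the density hypothesis of the S6 ED. 2b Hecke variation.)
[cite: Rogawski1990, §4.5 p. 50; p. 55] [cite: CartierCorvallis1979, §IV Thm. 4.1, Cor. 4.2] [cite: Minguez2011, §4] -/
theorem exists_hecke_eigenpoly_three (Q : ℂ[X]) :
    ∃ φ : heckeAlgebra ℂ ↥(unitaryGroupOfForm (galAdicCompletionMap (L := E) c hw) ((StdForm.antidiagonal 3).over (w.1.adicCompletion E)))
        (unitaryInt (galAdicCompletionMap (L := E) c hw) ((StdForm.antidiagonal 3).over (w.1.adicCompletion E))),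
      ∀ z : ℂˣ, unitaryHeckeEigencharacterAdic c hc1 v w hw hv ![z, 1, 1] φ = Q.eval ((z : ℂ) + (z : ℂ)⁻¹) := by
  obtain ⟨T₁, hT₁, -⟩ := exists_generator_unitaryHeckeAlgebraAdic_three c hc1 v w hw hv
  exact ⟨aeval T₁ Q, fun z => unitaryHeckeEigencharacterAdic_three_aeval c hc1 v w hw hv hT₁ Q z⟩

end Summit.HodgeConjecture.HodgeConjecture.R90.S6

end
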